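import Literature.Geometry.Kaehler.MayerVietoris
import Literature.Geometry.Kaehler.ChartTransport
import HarnessLib

/-!
# Finiteness of local de Rham cohomology: unions of chart-convex sets, chart domains

Support for the finite-dimensionality of de Rham cohomology
(`Literature.AlgebraicGeometry.Motives.finite_deRhamCohomology`). With the Mayer–Vietoris
connecting homomorphism (`Literature.Geometry.Kaehler.MayerVietoris`) and the Poincaré lemma on
chart-convex sets (`Literature.Geometry.Kaehler.ChartTransport`) we prove:

* `finite_localDeRham_union`: `H^k(U ∪ V)` is finite-dimensional if `H^k(U)`, `H^k(V)` and
  `H^{k-1}(U ∩ V)` are (the Mayer–Vietoris step of Bott–Tu (1982), Prop. 5.3.1);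
* `finite_localDeRham_biUnion_chartSet`: finite unions of chart-convex sets of ONE chart have
  finite-dimensional cohomology (induction on the number of sets; the intersections with a new
  set are again chart-convex sets of the same chart: Bott–Tu's good-cover induction, Lee (2013),
  Thm. 18.14, Step 3);
* `RelFinite I F U`: the hereditary *relative* finiteness property of an open set `U` — for all
  open `W' ⊆ U` and open `W` with compact closure inside `W'`, the image of
  `H^k(W') → H^k(W)` is finite-dimensional — and `relFinite_of_subset_source`: every open subset
  of a chart source has it (cover the compact closure by finitely many chart balls inside `W'`
  and factor the restriction through their union).

The relative property is what survives the passage to unions of different charts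
(`Literature.Geometry.Kaehler.DeRhamFinite`); it replaces the good covers of the textbook proof.

## References

* R. Bott, L. W. Tu, *Differential Forms in Algebraic Topology* (1982), Prop. 5.3.1, §I.5.
* J. M. Lee, *Introduction to Smooth Manifolds*, 2nd ed. (2013), Thm. 17.20, Thm. 18.14.
-/

noncomputable section

open scoped Manifold ContDiff Topology
open Bundle Set Filter

namespace Literature.Geometry.Kaehler

/-! ### Linear algebra -/

section LinearAlgebra

variable {X Y : Type*} [AddCommGroup X] [Module ℝ X] [AddCommGroup Y] [Module ℝ Y]

/-- A vector space with a finite-dimensional submodule of finite codimension is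
finite-dimensional (restatement of `Module.Finite.of_submodule_quotient`). [folklore] -/
theorem finite_of_finite_submodule_of_finite_quotient (N : Submodule ℝ X) (hN : Module.Finite ℝ N)
    (hQ : Module.Finite ℝ (X ⧸ N)) : Module.Finite ℝ X :=
  Module.Finite.of_submodule_quotient N

/-- A submodule contained in a finite-dimensional submodule is finite-dimensional. [folklore] -/
theorem finite_of_le {N N' : Submodule ℝ X} (h : N ≤ N') (hN' : Module.Finite ℝ N') :
    Module.Finite ℝ N :=
  Module.Finite.of_injective (Submodule.inclusion h) (Submodule.inclusion_injective h)

/-- **Finiteness of an image from finite codimension of a submodule and finiteness of its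
image**: if `X ⧸ N` and `r(N)` are finite-dimensional, so is `r(X)`. [folklore] -/
theorem finite_range_of_finite_quotient_of_finite_map (r : X →ₗ[ℝ] Y) (N : Submodule ℝ X)
    (hQ : Module.Finite ℝ (X ⧸ N)) (hN : Module.Finite ℝ (N.map r)) :
    Module.Finite ℝ (LinearMap.range r) := by
  -- the composite `X → Y → Y ⧸ r(N)` factors through `X ⧸ N`
  set q : Y →ₗ[ℝ] Y ⧸ N.map r := (N.map r).mkQ with hq
  have hle : N ≤ LinearMap.ker (q ∘ₗ r) := fun x hx ↦ by
    rw [LinearMap.mem_ker, LinearMap.comp_apply, hq, Submodule.mkQ_apply, Submodule.Quotient.mk_eq_zero]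
    exact Submodule.mem_map_of_mem hx
  have h1 : Module.Finite ℝ (LinearMap.range (q ∘ₗ r)) := by
    rw [← Submodule.range_liftQ N (q ∘ₗ r) hle]
    exact Module.Finite.range _
  -- restrict `q` to `range r`: finite range and finite kernel
  set q' : LinearMap.range r →ₗ[ℝ] Y ⧸ N.map r := q ∘ₗ (LinearMap.range r).subtype with hq'
  have hrange : LinearMap.range q' ≤ LinearMap.range (q ∘ₗ r) := by
    rintro _ ⟨⟨_, x, rfl⟩, rfl⟩
    exact ⟨x, rfl⟩
  have h2 : Module.Finite ℝ (LinearMap.range q') := finite_of_le hrange h1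
  have hker : Module.Finite ℝ (LinearMap.ker q') := by
    have hle' : (LinearMap.ker q').map (LinearMap.range r).subtype ≤ N.map r := by
      rintro _ ⟨y, hy, rfl⟩
      rw [SetLike.mem_coe, LinearMap.mem_ker, hq', LinearMap.comp_apply, hq, Submodule.mkQ_apply,
        Submodule.Quotient.mk_eq_zero] at hy
      exact hy
    haveI : Module.Finite ℝ ((LinearMap.ker q').map (LinearMap.range r).subtype) := finite_of_le hle' hN
    exact Module.Finite.equiv
      (Submodule.equivMapOfInjective _ (LinearMap.range r).injective_subtype (LinearMap.ker q')).symm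
  haveI := hker
  haveI : Module.Finite ℝ (LinearMap.range r ⧸ LinearMap.ker q') := Module.Finite.equiv q'.quotKerEquivRange.symm
  exact Module.Finite.of_submodule_quotient (LinearMap.ker q')

end LinearAlgebra

variable {E : Type*} [NormedAddCommGroup E] [NormedSpace ℝ E]
  {H : Type*} [TopologicalSpace H] {I : ModelWithCorners ℝ E H}
  {M : Type*} [TopologicalSpace M] [ChartedSpace H M]
  {F : Type*} [NormedAddCommGroup F] [NormedSpace ℝ F] {k : ℕ}

/-! ### Transport along equal open sets; the empty set -/

section Congr

variable [IsManifold I ∞ M]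

/-- Local de Rham cohomology of equal open sets: finiteness transfers. [folklore] -/
theorem finite_localDeRham_congr {U V : Set M} (hU : IsOpen U) (hV : IsOpen V) (h : U = V)
    (hfin : Module.Finite ℝ (LocalDeRham I F k hU)) : Module.Finite ℝ (LocalDeRham I F k hV) := by
  subst h
  exact hfin

/-- Every form on the empty set vanishes, so its cohomology is trivial. [folklore] -/
theorem localDeRham_empty_eq_zero (c : LocalDeRham I F k (isOpen_empty : IsOpen (∅ : Set M))) : c = 0 := by
  obtain ⟨α, rfl⟩ := LocalDeRham.mk_surjective _ c
  have h0 : (α : MForm I M F k) = 0 := funext fun x ↦ α.2.1.2 x (notMem_empty x)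
  have : α = 0 := Subtype.ext h0
  rw [this, _root_.map_zero]

/-- The cohomology of the empty set is finite-dimensional. [folklore] -/
theorem finite_localDeRham_empty : Module.Finite ℝ (LocalDeRham I F k (isOpen_empty : IsOpen (∅ : Set M))) := by
  haveI : Subsingleton (LocalDeRham I F k (isOpen_empty : IsOpen (∅ : Set M))) :=
    ⟨fun a b ↦ by rw [localDeRham_empty_eq_zero a, localDeRham_empty_eq_zero b]⟩
  exact Module.Finite.of_finite

end Congr

/-! ### The Mayer–Vietoris step -/

section MVStep

variable [FiniteDimensional ℝ E] [IsManifold I ∞ M] [T2Space M] [SecondCountableTopology M]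

/-- **Mayer–Vietoris step for finiteness**: for open `U`, `V`, if `H^k(U)`, `H^k(V)` are
finite-dimensional and (when `k = j + 1`) `H^j(U ∩ V)` is, then `H^k(U ∪ V)` is
finite-dimensional: the kernel of `(res_U, res_V)` lies in the image of the connecting
homomorphism, and the quotient by the kernel embeds in `H^k(U) ⊕ H^k(V)`. Bott–Tu (1982),
proof of Prop. 5.3.1; Lee (2013), Thm. 17.20. [cite: BottTu1982Forms, Prop. 5.3.1] -/
theorem finite_localDeRham_union {U V : Set M} (hU : IsOpen U) (hV : IsOpen V) (k : ℕ)
    (hfU : Module.Finite ℝ (LocalDeRham I F k hU)) (hfV : Module.Finite ℝ (LocalDeRham I F k hV))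
    (hfUV : ∀ j, j + 1 = k → Module.Finite ℝ (LocalDeRham I F j (hU.inter hV))) :
    Module.Finite ℝ (LocalDeRham I F k (hU.union hV)) := by
  haveI := hfU; haveI := hfV
  set g : LocalDeRham I F k (hU.union hV) →ₗ[ℝ] LocalDeRham I F k hU × LocalDeRham I F k hV :=
    (LocalDeRham.res I F k hU (hU.union hV) subset_union_left).prod
      (LocalDeRham.res I F k hV (hU.union hV) subset_union_right) with hg
  -- the quotient by the kernel is finite
  haveI : Module.Finite ℝ (LocalDeRham I F k (hU.union hV) ⧸ LinearMap.ker g) :=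
    Module.Finite.equiv g.quotKerEquivRange.symm
  -- the kernel is finite
  have hker : Module.Finite ℝ (LinearMap.ker g) := by
    cases k with
    | zero =>
      have hbot : LinearMap.ker g = ⊥ := by
        refine (Submodule.eq_bot_iff _).2 fun c hc ↦ ?_
        rw [LinearMap.mem_ker, hg, LinearMap.prod_apply, Prod.mk_eq_zero] at hc
        exact LocalDeRham.eq_zero_of_res_eq_zero hU hV hc.1 hc.2
      rw [hbot]
      exact Module.Finite.of_finite
    | succ j =>
      haveI := hfUV j rfl
      obtain ⟨b⟩ := exists_bumpPair (I := I) hU hV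
      have hle : LinearMap.ker g ≤ LinearMap.range (LocalDeRham.delta (F := F) (k := j) hU hV b) := by
        intro c hc
        rw [LinearMap.mem_ker, hg, LinearMap.prod_apply, Prod.mk_eq_zero] at hc
        obtain ⟨c', hc'⟩ := LocalDeRham.exists_delta_eq_res hU hV hU hV le_rfl le_rfl b hc.1 hc.2
        rw [LocalDeRham.res_self] at hc'
        exact ⟨_, hc'.symm⟩
      exact finite_of_le hle (Module.Finite.range _)
  exact finite_of_finite_submodule_of_finite_quotient _ hker inferInstance

end MVStep

/-! ### Finite unions of chart-convex sets -/

section ChartUnion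

variable [FiniteDimensional ℝ E] [FiniteDimensional ℝ F] [IsManifold I ∞ M] [I.Boundaryless] [T2Space M]
  [SecondCountableTopology M]

/-- **Finite unions of chart-convex sets of one chart have finite-dimensional cohomology**
(all degrees): induction on the number of sets by the Mayer–Vietoris step, the intersections of
the previous sets with the new one being chart-convex sets of the same chart
(`chartSet_inter`), and the Poincaré lemma (`finite_localDeRham_chartSet`) for a single set.
Bott–Tu (1982), Prop. 5.3.1 (finite good cover); Lee (2013), Thm. 18.14, Step 3. [cite: BottTu1982Forms, Prop. 5.3.1] -/
theorem finite_localDeRham_biUnion_chartSet {ι : Type*} (p : M) (s : Finset ι) :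
    ∀ (C : ι → Set E) (hCo : ∀ i ∈ s, IsOpen (C i)) (_hCc : ∀ i ∈ s, Convex ℝ (C i))
      (_hCT : ∀ i ∈ s, C i ⊆ (extChartAt I p).target) (k : ℕ),
      Module.Finite ℝ (LocalDeRham I F k
        (isOpen_biUnion fun i hi ↦ isOpen_chartSet I p (hCo i hi) :
          IsOpen (⋃ i ∈ s, chartSet I p (C i)))) := by
  classical
  induction s using Finset.induction_on with
  | empty =>
    intro C hCo hCc hCT k
    exact finite_localDeRham_congr isOpen_empty _ (by simp) finite_localDeRham_empty
  | insert a s ha ih =>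
    intro C hCo hCc hCT k
    have hV : IsOpen (chartSet I p (C a)) := isOpen_chartSet I p (hCo a (Finset.mem_insert_self a s))
    have hU : IsOpen (⋃ i ∈ s, chartSet I p (C i)) :=
      isOpen_biUnion fun i hi ↦ isOpen_chartSet I p (hCo i (Finset.mem_insert_of_mem hi))
    have hfU : ∀ k, Module.Finite ℝ (LocalDeRham I F k hU) := fun k ↦
      ih C (fun i hi ↦ hCo i (Finset.mem_insert_of_mem hi)) (fun i hi ↦ hCc i (Finset.mem_insert_of_mem hi))
        (fun i hi ↦ hCT i (Finset.mem_insert_of_mem hi)) k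
    have hfV : ∀ k, Module.Finite ℝ (LocalDeRham I F k hV) := fun k ↦
      finite_localDeRham_chartSet p (hCo a (Finset.mem_insert_self a s))
        (hCc a (Finset.mem_insert_self a s)) (hCT a (Finset.mem_insert_self a s)) k
    -- the intersections with the new set: chart sets of the convex sets `C i ∩ C a`
    have hUV' : IsOpen (⋃ i ∈ s, chartSet I p (C i ∩ C a)) :=
      isOpen_biUnion fun i hi ↦ isOpen_chartSet I p
        ((hCo i (Finset.mem_insert_of_mem hi)).inter (hCo a (Finset.mem_insert_self a s)))
    have hfUV : ∀ j, Module.Finite ℝ (LocalDeRham I F j (hV.inter hU)) := fun j ↦ by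
      refine finite_localDeRham_congr hUV' _ ?_ (ih (fun i ↦ C i ∩ C a)
        (fun i hi ↦ (hCo i (Finset.mem_insert_of_mem hi)).inter (hCo a (Finset.mem_insert_self a s)))
        (fun i hi ↦ (hCc i (Finset.mem_insert_of_mem hi)).inter (hCc a (Finset.mem_insert_self a s)))
        (fun i hi ↦ inter_subset_left.trans (hCT i (Finset.mem_insert_of_mem hi))) j)
      ext x
      simp only [mem_iUnion, mem_inter_iff, ← chartSet_inter, exists_and_right, exists_prop]
      tauto
    have h := finite_localDeRham_union hV hU k (hfV k) (hfU k) fun j _ ↦ hfUV j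
    exact finite_localDeRham_congr _ _ (Finset.set_biUnion_insert a s _).symm h

end ChartUnion

/-! ### The relative finiteness property -/

section RelFinite

variable [IsManifold I ∞ M]

variable (I F) in
/-- **Relative finiteness** of an open set `U`: for every open `W' ⊆ U` and every open `W` whose
closure is compact and contained in `W'`, the image of the restriction map `H^k(W') → H^k(W)`
is finite-dimensional, in every degree `k`. (Hereditary by definition; this is the property that
passes to finite unions of arbitrary open sets, `Literature.Geometry.Kaehler.DeRhamFinite`.)
[folklore] -/
def RelFinite (U : Set M) : Prop :=
  ∀ ⦃W' : Set M⦄ (hW' : IsOpen W'), W' ⊆ U → ∀ ⦃W : Set M⦄ (hW : IsOpen W), IsCompact (closure W) →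
    ∀ hWW' : closure W ⊆ W', ∀ k : ℕ,
      Module.Finite ℝ (LinearMap.range (LocalDeRham.res I F k hW hW' (subset_closure.trans hWW')))

/-- Relative finiteness is hereditary. [folklore] -/
theorem RelFinite.mono {U V : Set M} (h : RelFinite I F V) (hUV : U ⊆ V) : RelFinite I F U :=
  fun _ hW' hW'U ↦ h hW' (hW'U.trans hUV)

/-- If `H^k(V)` is finite-dimensional for an open `V` with `W ⊆ V ⊆ W'`, then the image of
`H^k(W') → H^k(W)` is finite-dimensional (it factors through `H^k(V)`). [folklore] -/
theorem finite_range_res_of_factor {W V W' : Set M} (hW : IsOpen W) (hV : IsOpen V) (hW' : IsOpen W')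
    (hWV : W ⊆ V) (hVW' : V ⊆ W') (hfin : Module.Finite ℝ (LocalDeRham I F k hV)) :
    Module.Finite ℝ (LinearMap.range (LocalDeRham.res I F k hW hW' (hWV.trans hVW'))) := by
  haveI := hfin
  have heq : LocalDeRham.res I F k hW hW' (hWV.trans hVW') =
      LocalDeRham.res I F k hW hV hWV ∘ₗ LocalDeRham.res I F k hV hW' hVW' := by
    apply LinearMap.ext
    intro c
    exact (LocalDeRham.res_comp hW hV hW' hWV hVW' c).symm
  rw [heq]
  exact finite_of_le (LinearMap.range_comp_le_range _ _) (Module.Finite.range _)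

variable [FiniteDimensional ℝ E] [FiniteDimensional ℝ F] [I.Boundaryless] [T2Space M]
  [SecondCountableTopology M]

/-- **Open subsets of a chart source are relatively finite**: the compact closure of `W` inside
`W' ⊆ (extChartAt I p).source` is covered by finitely many chart balls contained in `W'`, whose
union has finite-dimensional cohomology (`finite_localDeRham_biUnion_chartSet`), and the
restriction `H^k(W') → H^k(W)` factors through it. Bott–Tu (1982), Prop. 5.3.1; Lee (2013),
Thm. 18.14, Steps 5–6. [cite: BottTu1982Forms, Prop. 5.3.1] -/
theorem relFinite_of_subset_source (p : M) {U : Set M} (hU : U ⊆ (extChartAt I p).source) :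
    RelFinite I F U := by
  intro W' hW' hW'U W hW hKc hKW' k
  set e := extChartAt I p with he
  -- a chart ball inside `W'` around each point of the closure of `W`
  have hball : ∀ x ∈ closure W, ∃ r > 0, Metric.ball (e x) r ⊆ e.target ∩ e.symm ⁻¹' W' := by
    intro x hx
    have hxs : x ∈ e.source := hU (hW'U (hKW' hx))
    have hO : IsOpen (e.target ∩ e.symm ⁻¹' W') :=
      Literature.NumberTheory.Transcendental.isOpen_extChartAt_target_inter_preimage p hW'
    have hex : e x ∈ e.target ∩ e.symm ⁻¹' W' :=
      ⟨e.map_source hxs, by rw [mem_preimage, e.left_inv hxs]; exact hKW' hx⟩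
    exact Metric.isOpen_iff.1 hO (e x) hex
  choose! r hr hrW using hball
  have hcover : closure W ⊆ ⋃ x ∈ closure W, chartSet I p (Metric.ball (e x) (r x)) := by
    intro x hx
    refine mem_iUnion₂.2 ⟨x, hx, hU (hW'U (hKW' hx)), Metric.mem_ball_self (hr x hx)⟩
  obtain ⟨t, ht, htfin, htcover⟩ := hKc.elim_finite_subcover_image
    (fun x _ ↦ isOpen_chartSet I p Metric.isOpen_ball) hcover
  -- the finite union `V` of these chart balls
  set V : Set M := ⋃ x ∈ t, chartSet I p (Metric.ball (e x) (r x)) with hVdef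
  have hVo : IsOpen V := isOpen_biUnion fun x _ ↦ isOpen_chartSet I p Metric.isOpen_ball
  have hVW' : V ⊆ W' := by
    intro y hy
    obtain ⟨x, hxt, hyx⟩ := mem_iUnion₂.1 hy
    have h1 := hrW x (ht hxt) hyx.2
    have h2 : y = e.symm (e y) := (e.left_inv hyx.1).symm
    rw [h2]
    exact h1.2
  have hWV : W ⊆ V := subset_closure.trans htcover
  have hfin : Module.Finite ℝ (LocalDeRham I F k hVo) := by
    have h := finite_localDeRham_biUnion_chartSet (I := I) (F := F) p htfin.toFinset
      (fun x ↦ Metric.ball (e x) (r x)) (fun _ _ ↦ Metric.isOpen_ball) (fun _ _ ↦ convex_ball _ _)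
      (fun x hx ↦ (hrW x (ht ((Set.Finite.mem_toFinset htfin).1 hx))).trans inter_subset_left) k
    refine finite_localDeRham_congr _ hVo ?_ h
    rw [hVdef]
    ext y
    simp
  exact finite_range_res_of_factor hW hVo hW' hWV hVW' hfin

end RelFinite

end Literature.Geometry.Kaehler
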